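import Summits.CriticalPhenomena.PercolationContinuityZ3.Theorems.Transplant.SkelFrm1Closure
import Summits.CriticalPhenomena.PercolationContinuityZ3.Theorems.Transplant.SkelFrm1SlotTypes
import Summits.CriticalPhenomena.PercolationContinuityZ3.Theorems.Transplant.PlanarSkeletonFrmReflect
import Summits.CriticalPhenomena.PercolationContinuityZ3.Theorems.Transplant.SkelPhiReflect
import HarnessLib

/-!
# N2 (the frames-only node `SamePDropOfSkeletonFrm₁`, OPEN), WAVE 0 (c2) file 2: THE QUADRANT NORMALISATION — reflection covariance of the Step-I‴ records, the
# cofinal colour, the record `OutNS` WITH SELECTORS as the column reads it, and `PlanarSkeletonFrm.samePDropOfSkeletonFrm₁_of_stepI_outNS`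

Design of record (R-2)/(R-5)/(R-10)/(R-14)/(R-18)/(R-25) (N2-SCOPE §20–§21, p3 lineage): Martineau–Tassion's equilibrium without a point symmetry certifies ONE vertical side and
ONE slanted side per admissible pair — a COLOUR `(ori, quad) ∈ Bool × ℤˣ × ℤˣ`; hp-8's pigeonhole (`ScaleSel.exists_colourCofinal`, p331032) gives a cofinal colour
`c = (b, σ₀, σ₁)`; the closure then REFLECTS THE SKELETON ONCE — `Φ* := Φ.reflect s` (PlanarSkeletonFrmReflect, p333485) with `s = (σ₀, σ₁)` in orientation `b` (swapped
otherwise) — and hands the params column / the (R)/(F)/(C) ports / the oriented macro layer the record `O* : OutNS` of `Φ*` built with the SAME selectors for `D` and `DT`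
(`DataNS.ofSel`, p335948), whose served quadrant at every selected pair is `(1, 1) = (E, N)` and whose orientation is constant there.  So NOTHING downstream carries a reflection
slot ((R-25)); the sign edits in the ports are the specialisation `σ = 1` forced by `onwardO ⊆ {E, N}` ((R-18)).
builds on p205010 (kernel theorem, internal audit signed; external expert review pending) — nothing here uses p205010; the node stays OPEN: CONDITIONAL assembly.
Lane `prim-bschramm`, seat `prim-bschramm-p3` (gen 15; N2 design owner); helper file (`--supports stmt-CriticalPhenomena-4575 --as helper`).
* §1 chart level: `Skelφ.trφ_reflφ`, `swapS`, `cylBallFin_reflφ`, the `Classical.choose` congruence, **`fatRadius_reflφ` / `fatSeq_reflφ`** (the fat seed and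
  radius of a reflected chart are those of the chart — for ANY proofs of frames/Φ2);
* §2 record level: `DataN.reflectRec` (`hgt, spl ↦ s₀s₁·hgt, s₀s₁·spl`), `nearMul/farMul` (the sign bookkeeping), `pieceN_reflφ`, `regionN_reflφ`, `eventO_reflφ`,
  `eqGeom_reflφ/eqGeom_reflφ_tr`, the reflected quadrants `qdR/qdTR` with `sgQ_reflφ`, and the FAMILY TRANSPORT `family_reflφ` over `indexNQ`;
* §3 `Skelφ.StepI.OutNS.FactsNS` (= N1's `FactsO` for `O.toOutO` + the four selector facts) and **`PlanarSkeletonFrm.samePDropOfSkeletonFrm₁_of_stepI_outNS`** —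
  THE HYPOTHESIS the residue/choice tops discharge: for every one-type `Φ`, every `O : OutNS` with `FactsNS` (quadrant (1,1), orientation constant on selected pairs),
  return admissible `Sz, SMn` and, at each nearby density where the oriented family over `indexNQ` holds and Φ2 holds, `θ_t(q) > 0`.
[cite: MartineauTassion2017, §3.2 Lemma 3.2 (one side certified), Lemma 3.5, §3.3 Lemma 3.7] [cite: KozmaNitzan2024, §1 p. 2 (approach 1); §4 Theorem 6 (pp. 25–31), p. 16 (Lemma 8)]
-/

noncomputable section

open MeasureTheory ProbabilityTheory
open scoped ENNReal Classical

namespace Summit.CriticalPhenomena.PercolationContinuityZ3.Theorems.Transplant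

open Literature.Probability.Percolation Literature.Probability.LatticeModels SimpleGraph KNLevels
open Literature.Barriers.CriticalPhenomena (HasExponentialGrowth)

/-! ## §1 Chart level: transposition, finsets, and the fat radius under reflection -/

namespace Skelφ

variable {V : Type} {G : SimpleGraph V} {φ : V → Site 2} {types : Finset V}

/-- The swapped sign vector, named. [folklore] -/
def swapS (s : Fin 2 → ℤˣ) : Fin 2 → ℤˣ := fun i => s i.rev

/-- `swapS s 0 = s 1`. [folklore] -/
@[simp] theorem swapS_zero (s : Fin 2 → ℤˣ) : swapS s 0 = s 1 := rfl

/-- `swapS s 1 = s 0`. [folklore] -/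
@[simp] theorem swapS_one (s : Fin 2 → ℤˣ) : swapS s 1 = s 0 := rfl

/-- **Transposing a reflected chart reflects the transposed chart with swapped signs**: `trφ (reflφ s φ) = reflφ (swapS s) (trφ φ)`. [folklore] -/
theorem trφ_reflφ (s : Fin 2 → ℤˣ) (φ : V → Site 2) : trφ (reflφ s φ) = reflφ (swapS s) (trφ φ) := rfl

variable [G.LocallyFinite]

/-- The finite cylinder-ball is reflection-invariant. [folklore] -/
theorem cylBallFin_reflφ (s : Fin 2 → ℤˣ) (φ : V → Site 2) (t : V) (ℓ R : ℕ) : cylBallFin G (reflφ s φ) t ℓ R = cylBallFin G φ t ℓ R := by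
  ext v; rw [mem_cylBallFin, mem_cylBallFin, cylBall_reflφ]

omit [G.LocallyFinite] in
/-- `Classical.choose` of equal predicates agree (proof irrelevance after `subst`). [folklore] -/
theorem choose_congr_pred {α : Sort*} {p q : α → Prop} (hp : ∃ x, p x) (hq : ∃ x, q x) (e : p = q) : Classical.choose hp = Classical.choose hq := by
  subst e; rfl

/-- **The fat radius of a reflected chart is the fat radius of the chart** (for any proofs of the frames / Φ2 hypotheses): the defining events coincide as sets
(`cylBallFin_reflφ`, `cylReach_reflφ`), so each `Classical.choose` step agrees. [folklore] -/
theorem fatRadius_reflφ [Countable V] (s : Fin 2 → ℤˣ) (hfr : Frames G φ types) {p : unitInterval} (hC : CylSubcritical G φ types p)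
    (hfr' : Frames G (reflφ s φ) types) (hC' : CylSubcritical G (reflφ s φ) types p) : ∀ n, fatRadius hfr' hC' n = fatRadius hfr hC n
  | 0 => rfl
  | n + 1 => by
    have hc : ∀ r, Classical.choose (exists_ufatStep hfr' hC' r n) = Classical.choose (exists_ufatStep hfr hC r n) := fun r => by
      apply choose_congr_pred
      funext R
      simp only [cylBallFin_reflφ, cylReach_reflφ]
    show max (fatRadius hfr' hC' n + 1) (Classical.choose (exists_ufatStep hfr' hC' (fatRadius hfr' hC' n) n) + 1) =
      max (fatRadius hfr hC n + 1) (Classical.choose (exists_ufatStep hfr hC (fatRadius hfr hC n) n) + 1)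
    rw [hc, fatRadius_reflφ s hfr hC hfr' hC' n]

/-- **The fat seed of a reflected chart is the fat seed of the chart.** [folklore] -/
theorem fatSeq_reflφ [Countable V] (s : Fin 2 → ℤˣ) (hfr : Frames G φ types) {p : unitInterval} (hC : CylSubcritical G φ types p)
    (hfr' : Frames G (reflφ s φ) types) (hC' : CylSubcritical G (reflφ s φ) types p) : fatSeq hfr' hC' = fatSeq hfr hC := by
  funext t n
  show cylBallFin G (reflφ s φ) t n (fatRadius hfr' hC' n) = cylBallFin G φ t n (fatRadius hfr hC n)
  rw [cylBallFin_reflφ, fatRadius_reflφ s hfr hC hfr' hC' n]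

end Skelφ

/-! ## §2 Record level: the reflected records, piece/region/event covariance, the geometric clause, quadrants, family transport -/

namespace Skelφ.StepI

variable {V : Type} {G : SimpleGraph V} {φ : V → Site 2} {types : Finset V}

/-- **The reflected record**: shear and split point multiplied by `s₀s₁`; seed, radius, thresholds, half-length unchanged. [this work] -/
def DataN.reflectRec (D : DataN V) (s : Fin 2 → ℤˣ) : DataN V :=
  { D with hgt := fun t M n => (s 0 : ℤ) * (s 1 : ℤ) * D.hgt t M n, spl := fun t M n => (s 0 : ℤ) * (s 1 : ℤ) * D.spl t M n }

/-- Fields of the reflected record. [folklore] -/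
@[simp] theorem DataN.reflectRec_Λ (D : DataN V) (s : Fin 2 → ℤˣ) : (D.reflectRec s).Λ = D.Λ := rfl
/-- Fields of the reflected record. [folklore] -/
@[simp] theorem DataN.reflectRec_k (D : DataN V) (s : Fin 2 → ℤˣ) : (D.reflectRec s).k = D.k := rfl
/-- Fields of the reflected record. [folklore] -/
@[simp] theorem DataN.reflectRec_R (D : DataN V) (s : Fin 2 → ℤˣ) : (D.reflectRec s).R = D.R := rfl
/-- Fields of the reflected record. [folklore] -/
@[simp] theorem DataN.reflectRec_M₀ (D : DataN V) (s : Fin 2 → ℤˣ) : (D.reflectRec s).M₀ = D.M₀ := rfl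
/-- Fields of the reflected record. [folklore] -/
@[simp] theorem DataN.reflectRec_n₁ (D : DataN V) (s : Fin 2 → ℤˣ) : (D.reflectRec s).n₁ = D.n₁ := rfl
/-- Fields of the reflected record. [folklore] -/
@[simp] theorem DataN.reflectRec_len (D : DataN V) (s : Fin 2 → ℤˣ) : (D.reflectRec s).len = D.len := rfl
/-- Fields of the reflected record. [folklore] -/
@[simp] theorem DataN.reflectRec_hgt (D : DataN V) (s : Fin 2 → ℤˣ) (t : V) (M n : ℕ) :
    (D.reflectRec s).hgt t M n = (s 0 : ℤ) * (s 1 : ℤ) * D.hgt t M n := rfl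
/-- Fields of the reflected record. [folklore] -/
@[simp] theorem DataN.reflectRec_spl (D : DataN V) (s : Fin 2 → ℤˣ) (t : V) (M n : ℕ) :
    (D.reflectRec s).spl t M n = (s 0 : ℤ) * (s 1 : ℤ) * D.spl t M n := rfl

/-- The link-region scale is reflection-invariant. [folklore] -/
@[simp] theorem DataN.reflectRec_scale (D : DataN V) (s : Fin 2 → ℤˣ) (t : V) (M n : ℕ) : (D.reflectRec s).scale t M n = D.scale t M n := by
  unfold DataN.scale; rw [DataN.reflectRec_hgt, pgScale_reflHgt]; rfl

/-- Reflecting by the swapped signs is reflecting by the signs (only `s₀s₁` enters). [folklore] -/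
theorem DataN.reflectRec_swapS (D : DataN V) (s : Fin 2 → ℤˣ) : D.reflectRec (swapS s) = D.reflectRec s := by
  unfold DataN.reflectRec; simp only [swapS_zero, swapS_one, mul_comm (s 1 : ℤ) (s 0 : ℤ)]

/-- **The near-sign multiplier**: how the served sign of family `fam` transforms under `reflφ s` in orientation `b` (vertical side: the `α`-sign; slanted side: the
`β`-sign; transposed orientation: swapped). [this work] -/
def nearMul (s : Fin 2 → ℤˣ) (b : Bool) (fam : Fin 2) : ℤˣ :=
  if fam = 0 then (if b = true then s 0 else s 1) else (if b = true then s 1 else s 0)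

/-- **The far-sign multiplier**: how the far sign `τ` of family `fam` transforms (side halves: the other axis' sign; top pieces: `s₀s₁`). [this work] -/
def farMul (s : Fin 2 → ℤˣ) (b : Bool) (fam : Fin 2) : ℤˣ :=
  if fam = 0 then (if b = true then s 1 else s 0) else s 0 * s 1

/-- Units of `ℤ` are involutions. [folklore] -/
theorem units_mul_self' (u : ℤˣ) : u * u = 1 := by
  rcases Int.units_eq_one_or u with rfl | rfl <;> decide

/-- `u * (u * τ) = τ` for units of `ℤ`. [folklore] -/
theorem units_mul_mul_self (u τ : ℤˣ) : u * (u * τ) = τ := by rw [← mul_assoc, units_mul_self', one_mul]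

variable [G.LocallyFinite]

/-- **Piece covariance** (chart `reflφ s φ`, record `D.reflectRec s`, orientation `true`): the piece `(fam, nearMul·σ, farMul·τ)` of the reflected data is the piece
`(fam, σ, τ)` of the data. [this work] -/
theorem pieceN_reflφ (s : Fin 2 → ℤˣ) (D : DataN V) (t : V) (M n : ℕ) (fam : Fin 2) (σ τ : ℤˣ) :
    pieceN G (reflφ s φ) (D.reflectRec s) t M n fam (nearMul s true fam * σ) (farMul s true fam * τ) = pieceN G φ D t M n fam σ τ := by
  unfold pieceN
  by_cases hf : fam = 0
  · simp only [hf, ↓reduceIte, nearMul, farMul, Units.val_mul, DataN.reflectRec_hgt, DataN.reflectRec_len, DataN.reflectRec_R, DataN.reflectRec_scale]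
    exact pgSideHalfW_reflφ (G := G) s φ t n (D.hgt t M n) (D.len t M n) (D.R (D.scale t M n)) σ τ
  · simp only [hf, ↓reduceIte, nearMul, farMul, Units.val_mul, DataN.reflectRec_hgt, DataN.reflectRec_len, DataN.reflectRec_R, DataN.reflectRec_scale,
      DataN.reflectRec_spl]
    have := pgTopPieceW_reflφ (G := G) s φ t n (D.hgt t M n) (D.len t M n) (D.R (D.scale t M n)) σ τ (D.spl t M n)
    convert this using 2

/-- **Region covariance**: the link region of the reflected data is the link region of the data. [this work] -/
theorem regionN_reflφ (s : Fin 2 → ℤˣ) (D : DataN V) (t : V) (M n : ℕ) : regionN G (reflφ s φ) (D.reflectRec s) t M n = regionN G φ D t M n := by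
  unfold regionN
  rw [DataN.reflectRec_hgt, DataN.reflectRec_len, DataN.reflectRec_R, DataN.reflectRec_scale, pgramPrism_reflφ (G := G)]

/-- **Event covariance in orientation `true`.** [this work] -/
theorem eventN_reflφ_some (s : Fin 2 → ℤˣ) (D : DataN V) (t : V) (M n : ℕ) (fam : Fin 2) (σ τ : ℤˣ) :
    eventN G (reflφ s φ) (D.reflectRec s) (t, M, some (n, fam, nearMul s true fam * σ, farMul s true fam * τ)) = eventN G φ D (t, M, some (n, fam, σ, τ)) := by
  simp only [eventN, regionN_reflφ, pieceN_reflφ, DataN.reflectRec_Λ, DataN.reflectRec_k]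

/-- `nearMul (swapS s) true = nearMul s false`. [folklore] -/
theorem nearMul_swapS (s : Fin 2 → ℤˣ) (fam : Fin 2) : nearMul (swapS s) true fam = nearMul s false fam := by
  unfold nearMul; by_cases hf : fam = 0 <;> simp [hf]

/-- `farMul (swapS s) true = farMul s false`. [folklore] -/
theorem farMul_swapS (s : Fin 2 → ℤˣ) (fam : Fin 2) : farMul (swapS s) true fam = farMul s false fam := by
  unfold farMul; by_cases hf : fam = 0 <;> simp [hf, mul_comm]

/-- **Oriented-event covariance** (both orientations): the oriented input `(fam, nearMul·σ, farMul·τ)` of the reflected data `(reflφ s φ, D.reflectRec s, DT.reflectRec s)`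
is the oriented input `(fam, σ, τ)` of the data — in orientation `false` the chart is `trφ (reflφ s φ) = reflφ (swapS s) (trφ φ)`. [this work] -/
theorem eventO_reflφ (s : Fin 2 → ℤˣ) (D DT : DataN V) (ori : V → ℕ → ℕ → Bool) (t : V) (M n : ℕ) (fam : Fin 2) (σ τ : ℤˣ) :
    eventO G (reflφ s φ) (D.reflectRec s) (DT.reflectRec s) ori (t, M, some (n, fam, nearMul s (ori t M n) fam * σ, farMul s (ori t M n) fam * τ)) =
      eventO G φ D DT ori (t, M, some (n, fam, σ, τ)) := by
  rw [eventO_some, eventO_some]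
  cases hb : ori t M n
  · simp only [Bool.false_eq_true, ↓reduceIte]
    rw [trφ_reflφ, ← DataN.reflectRec_swapS DT s, ← nearMul_swapS, ← farMul_swapS]
    exact eventN_reflφ_some (φ := trφ φ) (swapS s) DT t M n fam σ τ
  · simp only [↓reduceIte]
    exact eventN_reflφ_some s D t M n fam σ τ

/-- **The geometric clause is reflection-covariant** (orientation `true`). [this work] -/
theorem eqGeom_reflφ (s : Fin 2 → ℤˣ) {D : DataN V} {t : V} {M n : ℕ} (h : D.EqGeom G φ t M n) : (D.reflectRec s).EqGeom G (reflφ s φ) t M n := by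
  obtain ⟨h1, h2, h3, h4, h5⟩ := h
  refine ⟨h1, h2, ?_, ?_, fun fam σ τ => ?_⟩
  · show |(s 0 : ℤ) * (s 1 : ℤ) * D.spl t M n| ≤ n
    rw [mul_assoc, BGN.abs_units_mul, BGN.abs_units_mul]; exact h3
  · show (M + 1 : ℤ) * (n + ((s 0 : ℤ) * (s 1 : ℤ) * D.hgt t M n).natAbs : ℕ) ≤ (n : ℤ) * (D.len t M n + 1 : ℕ)
    rw [natAbs_reflHgt]; exact h4
  · -- write `σ = nearMul·σ'`, `τ = farMul·τ'` and transport the piece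
    have e := pieceN_reflφ (G := G) (φ := φ) s D t M n fam (nearMul s true fam * σ) (farMul s true fam * τ)
    rw [units_mul_mul_self, units_mul_mul_self] at e
    rw [e, cyl_reflφ]
    exact h5 fam _ _

/-- **The geometric clause is reflection-covariant** (orientation `false`: chart `trφ`). [this work] -/
theorem eqGeom_reflφ_tr (s : Fin 2 → ℤˣ) {DT : DataN V} {t : V} {M n : ℕ} (h : DT.EqGeom G (trφ φ) t M n) :
    (DT.reflectRec s).EqGeom G (trφ (reflφ s φ)) t M n := by
  rw [trφ_reflφ, ← DataN.reflectRec_swapS DT s]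
  exact eqGeom_reflφ (φ := trφ φ) (swapS s) h

omit [G.LocallyFinite] in
/-- **The reflected quadrants** of the chart `φ`: `(s₀·qd₁, s₁·qd₂)`. [this work] -/
def qdR (s : Fin 2 → ℤˣ) (qd : V → ℕ → ℕ → ℤˣ × ℤˣ) (t : V) (M n : ℕ) : ℤˣ × ℤˣ := (s 0 * (qd t M n).1, s 1 * (qd t M n).2)

omit [G.LocallyFinite] in
/-- **The reflected quadrants** of the transposed chart: `(s₁·qdT₁, s₀·qdT₂)`. [this work] -/
def qdTR (s : Fin 2 → ℤˣ) (qdT : V → ℕ → ℕ → ℤˣ × ℤˣ) (t : V) (M n : ℕ) : ℤˣ × ℤˣ := (s 1 * (qdT t M n).1, s 0 * (qdT t M n).2)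

omit [G.LocallyFinite] in
/-- **The served sign transforms by `nearMul`.** [this work] -/
theorem sgQ_reflφ (s : Fin 2 → ℤˣ) (qd qdT : V → ℕ → ℕ → ℤˣ × ℤˣ) (ori : V → ℕ → ℕ → Bool) (t : V) (M n : ℕ) (fam : Fin 2) :
    sgQ (qdR s qd) (qdTR s qdT) ori t M n fam = nearMul s (ori t M n) fam * sgQ qd qdT ori t M n fam := by
  unfold sgQ qdR qdTR famSign nearMul
  cases ori t M n <;> by_cases hf : fam = 0 <;> simp [hf]

/-- **FAMILY TRANSPORT**: if the oriented family of the data over `indexNQ types Sz SMn (sgQ qd qdT ori)` is `c`-likely under `μ`, so is the oriented family of the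
REFLECTED data over `indexNQ types Sz SMn (sgQ (qdR s qd) (qdTR s qdT) ori)` — the events coincide. [this work] -/
theorem family_reflφ (s : Fin 2 → ℤˣ) (D DT : DataN V) (qd qdT : V → ℕ → ℕ → ℤˣ × ℤˣ) (ori : V → ℕ → ℕ → Bool) {Sz : Finset ℕ} {SMn : Finset (ℕ × ℕ)}
    {μ : Measure (BondConfig V)} {c : ℝ} (h : ∀ i ∈ indexNQ types Sz SMn (sgQ qd qdT ori), c < μ.real (eventO G φ D DT ori i)) :
    ∀ i ∈ indexNQ types Sz SMn (sgQ (qdR s qd) (qdTR s qdT) ori), c < μ.real (eventO G (reflφ s φ) (D.reflectRec s) (DT.reflectRec s) ori i) := by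
  intro i hi
  obtain ⟨ht, hog⟩ := of_mem_indexNQ hi
  obtain ⟨t, M, og⟩ := i
  simp only at ht hog
  rcases hog with ⟨hM, rfl⟩ | ⟨q, hq, rfl, fam, τ, rfl⟩
  · rw [eventO_none, DataN.reflectRec_Λ, DataN.reflectRec_k]
    have := h _ (mem_indexNQ_none ht hM)
    rwa [eventO_none] at this
  · rw [sgQ_reflφ]
    have e := eventO_reflφ (G := G) (φ := φ) s D DT ori t q.1 q.2 fam (sgQ qd qdT ori t q.1 q.2 fam) (farMul s (ori t q.1 q.2) fam * τ)
    rw [units_mul_mul_self] at e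
    rw [e]
    exact h _ (mem_indexNQ_some ht (by exact hq) fam _)

end Skelφ.StepI

/-! ## §3 The record with selectors as the column reads it, its facts, and the closure over it -/

namespace Skelφ.StepI

variable {V : Type} {G : SimpleGraph V}

/-- **The facts the closure hands the params column with `O : OutNS`** (frames `hfr` and Φ2 `hC` OF THE (REFLECTED) SKELETON the column works on, least seed level `m₀`,
base vertex `t`): N1's `FactsO` for `O.toOutO` (seed/radius/zone family of record, shared fields, the geometric clause + shear bound per orientation at every admissible
pair), and the SELECTOR facts of (R-14)/(R-25): selected pairs are admissible, the served quadrant there is `(1, 1) = (E, N)`, the orientation is constant on selected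
pairs, and `DT` carries the same selectors as `D`. [this work] -/
def OutNS.FactsNS {φ : V → Site 2} {types : Finset V} [Countable V] [G.LocallyFinite] (hfr : Frames G φ types) {p : unitInterval}
    (hC : CylSubcritical G φ types p) (m₀ : ℕ) (t : V) (O : OutNS V) : Prop :=
  O.toOutO.FactsO (G := G) hfr hC m₀ t ∧
    (∀ M₁ N, O.D.M₀ ≤ O.D.sM M₁ ∧ O.D.n₁ (O.D.sM M₁) ≤ O.D.sN M₁ N) ∧
    (∀ M₁ N, O.quad t (O.D.sM M₁) (O.D.sN M₁ N) = (1, 1)) ∧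
    (∀ M₁ N M₁' N', O.ori t (O.D.sM M₁) (O.D.sN M₁ N) = O.ori t (O.D.sM M₁') (O.D.sN M₁' N')) ∧
    (O.DT.sM = O.D.sM ∧ O.DT.sN = O.D.sN)

/-- Projections of `FactsNS`: N1's facts of the underlying output. [folklore] -/
theorem OutNS.FactsNS.factsO {φ : V → Site 2} {types : Finset V} [Countable V] [G.LocallyFinite] {hfr : Frames G φ types} {p : unitInterval}
    {hC : CylSubcritical G φ types p} {m₀ : ℕ} {t : V} {O : OutNS V} (h : O.FactsNS (G := G) hfr hC m₀ t) : O.toOutO.FactsO (G := G) hfr hC m₀ t := h.1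

/-- Projections of `FactsNS`: selected pairs are admissible. [folklore] -/
theorem OutNS.FactsNS.sel_adm {φ : V → Site 2} {types : Finset V} [Countable V] [G.LocallyFinite] {hfr : Frames G φ types} {p : unitInterval}
    {hC : CylSubcritical G φ types p} {m₀ : ℕ} {t : V} {O : OutNS V} (h : O.FactsNS (G := G) hfr hC m₀ t) (M₁ N : ℕ) :
    O.D.M₀ ≤ O.D.sM M₁ ∧ O.D.n₁ (O.D.sM M₁) ≤ O.D.sN M₁ N := h.2.1 M₁ N

/-- Projections of `FactsNS`: the served quadrant at a selected pair is `(E, N)`. [folklore] -/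
theorem OutNS.FactsNS.sel_quad {φ : V → Site 2} {types : Finset V} [Countable V] [G.LocallyFinite] {hfr : Frames G φ types} {p : unitInterval}
    {hC : CylSubcritical G φ types p} {m₀ : ℕ} {t : V} {O : OutNS V} (h : O.FactsNS (G := G) hfr hC m₀ t) (M₁ N : ℕ) :
    O.quad t (O.D.sM M₁) (O.D.sN M₁ N) = (1, 1) := h.2.2.1 M₁ N

/-- Projections of `FactsNS`: the orientation is constant on selected pairs. [folklore] -/
theorem OutNS.FactsNS.sel_ori {φ : V → Site 2} {types : Finset V} [Countable V] [G.LocallyFinite] {hfr : Frames G φ types} {p : unitInterval}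
    {hC : CylSubcritical G φ types p} {m₀ : ℕ} {t : V} {O : OutNS V} (h : O.FactsNS (G := G) hfr hC m₀ t) (M₁ N M₁' N' : ℕ) :
    O.ori t (O.D.sM M₁) (O.D.sN M₁ N) = O.ori t (O.D.sM M₁') (O.D.sN M₁' N') := h.2.2.2.1 M₁ N M₁' N'

/-- Projections of `FactsNS`: `DT` carries `D`'s selectors. [folklore] -/
theorem OutNS.FactsNS.selT {φ : V → Site 2} {types : Finset V} [Countable V] [G.LocallyFinite] {hfr : Frames G φ types} {p : unitInterval}
    {hC : CylSubcritical G φ types p} {m₀ : ℕ} {t : V} {O : OutNS V} (h : O.FactsNS (G := G) hfr hC m₀ t) : O.DT.sM = O.D.sM ∧ O.DT.sN = O.D.sN := h.2.2.2.2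

end Skelφ.StepI

namespace PlanarSkeletonFrm

variable {V : Type} {G : SimpleGraph V} [G.LocallyFinite]

/-- **THE CLOSURE OF THE FRAMES-ONLY NODE OVER THE NORMALISED RECORD (single type).**  Suppose that for every locally finite `G` NOT of exponential growth with a one-type
`PlanarSkeletonFrm Φ` (`Φ.types = {t}`), every `0 < p < 1` with a.s. uniqueness, Φ2 (`hC`) and `θ_t(p) > 0`, the instance names `0 < δI < 1` and `m₀`; receives a record
WITH SELECTORS `O : OutNS V` satisfying `O.FactsNS Φ.frame hC m₀ t` — in particular the served quadrant at every selected pair is `(E, N)` and the orientation is constant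
there; returns admissible finite lists `Sz`, `SMn`; and at every `q ∈ [p/2, p]` where the oriented family over `indexNQ {t} Sz SMn (sgQ O.qd O.qdT O.ori)` holds with
accuracy `δI` and Φ2 holds, proves `θ_t(q) > 0`.  Then `SamePDropOfSkeletonFrm₁`.  (Proof: from `samePDropOfSkeletonFrm₁_of_stepI_frQ` by the quadrant normalisation —
cofinal colour, `Φ.reflect s`, `DataNS.ofSel (·.reflectRec s)`, covariance §1–§2; `δI`/`m₀` are the min/max over the four sign vectors.)
[cite: KozmaNitzan2024, §1 p. 2 (approach 1); §4 Theorem 6 (pp. 25–31), p. 16 (Lemma 8), p. 17] [cite: MartineauTassion2017, §3.2 Lemma 3.2, §3.3 Lemma 3.7] -/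
theorem samePDropOfSkeletonFrm₁_of_stepI_outNS
    (h : ∀ {V : Type} [DecidableEq V] [Countable V] (G : SimpleGraph V) [G.LocallyFinite] (Φ : PlanarSkeletonFrm G),
      ¬ HasExponentialGrowth G → ∀ t ∈ Φ.types, Φ.types = {t} → ∀ p : unitInterval, 0 < (p : ℝ) → (p : ℝ) < 1 →
        (∀ᵐ ω ∂bondPercolation G p, numInfiniteClusters ω ≤ 1) → ∀ hC : Φ.CylSubcritical p, 0 < theta G t p →
          ∃ (δI : ℝ) (m₀ : ℕ), 0 < δI ∧ δI < 1 ∧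
            ∀ O : Skelφ.StepI.OutNS V, O.FactsNS (G := G) Φ.frame hC m₀ t →
              ∃ (Sz : Finset ℕ) (SMn : Finset (ℕ × ℕ)), (∀ M ∈ Sz, O.D.M₀ ≤ M) ∧ (∀ q ∈ SMn, O.D.M₀ ≤ q.1 ∧ O.D.n₁ q.1 ≤ q.2) ∧
                ∀ q : unitInterval, (p : ℝ) / 2 ≤ q → (q : ℝ) ≤ p →
                  (∀ i ∈ Skelφ.StepI.indexNQ {t} Sz SMn (Skelφ.StepI.sgQ O.qd O.qdT O.ori),
                    1 - δI < (bondPercolation G q).real (Skelφ.StepI.eventO G Φ.φ O.D.toDataN O.DT.toDataN O.ori i)) →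
                  Φ.CylSubcritical q → 0 < theta G t q) :
    SamePDropOfSkeletonFrm₁ := by
  refine samePDropOfSkeletonFrm₁_of_stepI_frQ fun {V} _ _ G _ Φ hg t ht h1 p hp0 hp1 hU hC hθ => ?_
  -- the hypothesis at each of the four reflected skeletons, up front
  have hall : ∀ s : Fin 2 → ℤˣ, ∃ (δI : ℝ) (m₀ : ℕ), 0 < δI ∧ δI < 1 ∧
      ∀ O : Skelφ.StepI.OutNS V, O.FactsNS (G := G) (Φ.reflect s).frame ((Φ.reflect_cylSubcritical_iff s p).2 hC) m₀ t →
        ∃ (Sz : Finset ℕ) (SMn : Finset (ℕ × ℕ)), (∀ M ∈ Sz, O.D.M₀ ≤ M) ∧ (∀ q ∈ SMn, O.D.M₀ ≤ q.1 ∧ O.D.n₁ q.1 ≤ q.2) ∧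
          ∀ q : unitInterval, (p : ℝ) / 2 ≤ q → (q : ℝ) ≤ p →
            (∀ i ∈ Skelφ.StepI.indexNQ {t} Sz SMn (Skelφ.StepI.sgQ O.qd O.qdT O.ori),
              1 - δI < (bondPercolation G q).real (Skelφ.StepI.eventO G (Φ.reflect s).φ O.D.toDataN O.DT.toDataN O.ori i)) →
            (Φ.reflect s).CylSubcritical q → 0 < theta G t q :=
    fun s => h G (Φ.reflect s) hg t ht h1 p hp0 hp1 hU ((Φ.reflect_cylSubcritical_iff s p).2 hC) hθ
  choose δIf m₀f hδIf0 hδIf1 hrest using hall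
  obtain ⟨s₀, -, hs₀⟩ := Finset.exists_min_image Finset.univ δIf ⟨1, Finset.mem_univ _⟩
  refine ⟨δIf s₀, Finset.univ.sup m₀f, hδIf0 s₀, hδIf1 s₀, ?_⟩
  intro D DT qd qdT ori hk₀ hk₁ hkM hR hΛ e1 e2 e3 e4 e5 hgeom
  -- admissibility and colour; a cofinal colour
  let adm : ℕ → ℕ → Prop := fun M n => D.M₀ ≤ M ∧ D.n₁ M ≤ n
  let col : ℕ → ℕ → Bool × (ℤˣ × ℤˣ) := fun M n => (ori t M n, if ori t M n = true then qd t M n else qdT t M n)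
  have hadm : Skelφ.ScaleSel.AdmCofinal adm D.M₀ := fun M hM N => ⟨max N (D.n₁ M), le_max_left _ _, hM, le_max_right _ _⟩
  obtain ⟨c, hc⟩ := Skelφ.ScaleSel.exists_colourCofinal hadm col
  -- the normalising signs and the reflected skeleton
  let s : Fin 2 → ℤˣ := if c.1 = true then ![c.2.1, c.2.2] else ![c.2.2, c.2.1]
  set Ψ : PlanarSkeletonFrm G := Φ.reflect s with hΨ
  have hCΨ : Ψ.CylSubcritical p := (Φ.reflect_cylSubcritical_iff s p).2 hC
  -- the record with selectors of the reflected skeleton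
  let Ds : Skelφ.StepI.DataNS V := Skelφ.StepI.DataNS.ofSel (D.reflectRec s) hc
  let DTs : Skelφ.StepI.DataNS V := Skelφ.StepI.DataNS.ofSel (DT.reflectRec s) hc
  let O : Skelφ.StepI.OutNS V := ⟨Ds, DTs, ori, Skelφ.StepI.qdR s qd, Skelφ.StepI.qdTR s qdT⟩
  -- its facts
  have hcol : ∀ M₁ N, ori t (Ds.sM M₁) (Ds.sN M₁ N) = c.1 ∧ (if ori t (Ds.sM M₁) (Ds.sN M₁ N) = true then qd t (Ds.sM M₁) (Ds.sN M₁ N)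
      else qdT t (Ds.sM M₁) (Ds.sN M₁ N)) = c.2 := fun M₁ N => by
    have := (Skelφ.StepI.DataNS.ofSel_adm_col (D.reflectRec s) hc M₁ N).2
    exact ⟨congrArg Prod.fst this, congrArg Prod.snd this⟩
  have hfacts : O.FactsNS (G := G) Ψ.frame hCΨ (m₀f s) t := by
    refine ⟨⟨(Finset.le_sup (f := m₀f) (Finset.mem_univ s)).trans hk₀, hk₁, hkM, ?_, ?_, e1, e2, e3, e4, e5, fun M hM n hn => ?_⟩, ?_, ?_, ?_, ⟨rfl, rfl⟩⟩
    · show D.R = Skelφ.fatRadius Ψ.frame _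
      rw [hR]; exact (funext (Skelφ.fatRadius_reflφ (φ := Φ.φ) (types := Φ.types) s Φ.frame hC Ψ.frame hCΨ)).symm
    · show D.Λ = Skelφ.fatSeq Ψ.frame _
      rw [hΛ]; exact (Skelφ.fatSeq_reflφ (φ := Φ.φ) (types := Φ.types) s Φ.frame hC Ψ.frame hCΨ).symm
    · obtain ⟨ha, hb⟩ := hgeom M hM n hn
      refine ⟨fun ho => ⟨Skelφ.StepI.eqGeom_reflφ s (ha ho).1, ?_⟩, fun ho => ⟨Skelφ.StepI.eqGeom_reflφ_tr s (hb ho).1, ?_⟩⟩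
      · show ((s 0 : ℤ) * (s 1 : ℤ) * D.hgt t M n).natAbs ≤ 10 * n
        rw [Skelφ.natAbs_reflHgt]; exact (ha ho).2
      · show ((s 0 : ℤ) * (s 1 : ℤ) * DT.hgt t M n).natAbs ≤ 10 * n
        rw [Skelφ.natAbs_reflHgt]; exact (hb ho).2
    · intro M₁ N
      exact (Skelφ.StepI.DataNS.ofSel_adm_col (D.reflectRec s) hc M₁ N).1
    · intro M₁ N
      obtain ⟨ho, hq⟩ := hcol M₁ N
      show (if ori t (Ds.sM M₁) (Ds.sN M₁ N) = true then Skelφ.StepI.qdR s qd t (Ds.sM M₁) (Ds.sN M₁ N)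
        else Skelφ.StepI.qdTR s qdT t (Ds.sM M₁) (Ds.sN M₁ N)) = (1, 1)
      obtain ⟨b, σ₀, σ₁⟩ := c
      simp only at ho hq
      cases b
      · rw [ho] at hq ⊢
        simp only [Bool.false_eq_true, ↓reduceIte] at hq ⊢
        simp only [Skelφ.StepI.qdTR, hq, s, Bool.false_eq_true, ↓reduceIte, Matrix.cons_val_zero, Matrix.cons_val_one,
          Skelφ.StepI.units_mul_self', Prod.mk_one_one]
      · rw [ho] at hq ⊢
        simp only [↓reduceIte] at hq ⊢
        simp only [Skelφ.StepI.qdR, hq, s, ↓reduceIte, Matrix.cons_val_zero, Matrix.cons_val_one, Skelφ.StepI.units_mul_self', Prod.mk_one_one]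
    · intro M₁ N M₁' N'
      show ori t (Ds.sM M₁) (Ds.sN M₁ N) = ori t (Ds.sM M₁') (Ds.sN M₁' N')
      rw [(hcol M₁ N).1, (hcol M₁' N').1]
  -- the residues' answer for the reflected skeleton, transported back
  obtain ⟨Sz, SMn, hSz, hSMn, hend⟩ := hrest s O hfacts
  refine ⟨Sz, SMn, hSz, hSMn, fun q hq1 hq2 hfam hCq => hend q hq1 hq2 ?_ ((Φ.reflect_cylSubcritical_iff s q).2 hCq)⟩
  have hmin : δIf s₀ ≤ δIf s := hs₀ s (Finset.mem_univ _)
  intro i hi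
  have := Skelφ.StepI.family_reflφ (G := G) (φ := Φ.φ) (types := ({t} : Finset V)) s D DT qd qdT ori (μ := bondPercolation G q) hfam i hi
  exact lt_of_le_of_lt (by linarith) this

end PlanarSkeletonFrm

end Summit.CriticalPhenomena.PercolationContinuityZ3.Theorems.Transplant

end
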